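import Literature.AlgebraicGeometry.HodgeTheory.HypersurfaceLefschetzProofs
import Literature.AlgebraicGeometry.HodgeTheory.AlgebraicClassesCup
import Literature.AlgebraicGeometry.HodgeTheory.ClassesSupportedOn
import HarnessLib

/-!
# Classes restricted from projective space are movable; the moving lemma and `Nˡ ∪ Nᵏ ⊆ Nˡ⁺ᵏ` on `ℙᴺ`

Family `hodge`. The tree's `AlgebraicClassesCup.cupProduct_mem_algebraicClasses_of_moving` reduces
Voisin II Prop. 9.20 on a smooth projective `X` (`Nˡ H²ˡ ∪ Nᵏ H²ᵏ ⊆ Nˡ⁺ᵏ H²ˡ⁺²ᵏ`) to a MOVING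
hypothesis: classes killed off a closed `Z` of codimension `≥ l` lie in the span of classes killed
off closed `T` meeting a given closed `W` (codimension `≥ k`) in codimension `≥ l + k` — "in print
the hypothesis is where Chow's moving lemma enters". The classical first half of the moving lemma
(Eisenbud–Harris, 3264 & All That, §1.3; Fulton §11.4; Hartshorne I Thm. 7.2: linear subspaces in
GENERAL POSITION) moves the classes that come from the ambient projective space. This file proves,
for `Y` smooth projective of dimension `n` over `ℂ`, any morphism `ι : Y → ℙᴺ_ℂ` and any
Zariski-closed `W ⊆ Y` with every point of codimension `≥ k`:

* `exists_linForms_height_add_le_of_closed` — independent linear forms `ℓ₁, …, ℓ_j` with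
  `dim {z}⁻ + j ≤ n - k` for every `z ∈ W` with `ι z ∈ V₊(ℓ₁, …, ℓ_j)` (the induction of the tree's
  `exists_linForms_height_add_le`, run inside `W`: `ℓ_{j+1}` avoids the generic points of the
  components of `W ∩ ι⁻¹V₊(ℓ₁, …, ℓ_j)`);
* `exists_linearSubspace_le_coheight_inter` — hence a codimension-`l` linear subspace `L ⊂ ℙᴺ`
  with every point of `ι⁻¹L ∩ W` of codimension `≥ l + k` in `Y`;
* `map_projectiveSpace_mem_iSup_ker_restrictCompl` — **every `ι^* a`, `a ∈ H²ˡ(ℙᴺ(ℂ); ℂ)`, is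
  killed off such an `ι⁻¹L`** (it vanishes off `ι⁻¹L` because `a` vanishes on `(ℙᴺ ∖ L)(ℂ)`,
  the tree's `restrictCompl_preimage_map_eq_zero`): pulled-back ambient classes satisfy the moving
  hypothesis;
* `projectiveSpace_moving`, `projectiveSpace_cupProduct_mem_algebraicClasses` — for `Y = ℙᴺ`
  itself (`ι = 𝟙`) every class is ambient, so the moving hypothesis holds and
  **`Nˡ H²ˡ(ℙᴺ(ℂ)) ∪ Nᵏ H²ᵏ(ℙᴺ(ℂ)) ⊆ Nˡ⁺ᵏ H²ˡ⁺²ᵏ(ℙᴺ(ℂ))`** unconditionally (Voisin II Prop. 9.20 for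
  projective space).

## References
* [Hartshorne1977] R. Hartshorne, Algebraic Geometry, I Thm. 7.2, I Ex. 1.8, II Ex. 3.20.
* [EisenbudHarris2016] D. Eisenbud, J. Harris, 3264 and All That, CUP 2016, §1.3.
* [Fulton1998] W. Fulton, Intersection Theory, 2nd ed. 1998, §11.4, §19.1.
* [VoisinHodgeII2003] C. Voisin, Hodge Theory and Complex Algebraic Geometry II, §9.2.4 Prop. 9.20,
  Lemma 9.22; §1.2.3 Cor. 1.24.

#harness_tags algebraic_geometry.hodge_theory, topology.projective_space
-/

noncomputable section

open scoped LinearAlgebra.Projectivization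
open CategoryTheory AlgebraicGeometry Topology
open Literature.AlgebraicTopology.SingularHomology

namespace Literature.AlgebraicGeometry.HodgeTheory

attribute [local instance] MvPolynomial.gradedAlgebra

section LinearSections

variable {N : ℕ}

local notation "𝓐" => MvPolynomial.homogeneousSubmodule (Fin (N + 1)) ℂ

variable {n : ℕ} {Y : Motives.SchemeOver ℂ}

/-- **Linear forms in general position with respect to a closed `W ⊆ Y → ℙᴺ`** (Hartshorne I
Thm. 7.2 / I Ex. 1.8, the dimension count of the moving lemma, Eisenbud–Harris §1.3): for `Y`
smooth projective of dimension `n` over `ℂ`, `ι : Y → ℙᴺ_ℂ`, `W ⊆ Y` Zariski-closed with every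
point of codimension `≥ k`, and `j ≤ N + 1`, there are `j` linearly independent linear forms
`ℓ₁, …, ℓ_j` such that every `z ∈ W` with `ι(z) ∈ V₊(ℓ₁, …, ℓ_j)` has `dim {z}⁻ + j + k ≤ n`.
Induction on `j`, `ℓ_{j+1}` being chosen off the proper subspaces of forms vanishing at the generic
points of the irreducible components of `W ∩ ι⁻¹V₊(ℓ₁, …, ℓ_j)` and off the span of the previous
forms. [cite: Hartshorne1977, I Thm. 7.2 and I Ex. 1.8] [cite: EisenbudHarris2016, §1.3] -/
theorem exists_linForms_height_add_le_of_closed (hY : Motives.IsSmoothProjective n Y)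
    (ι : Y ⟶ Motives.projectiveSpace N ℂ) {W : Set Y.left} (hW : IsClosed W) {k : ℕ}
    (hWk : ∀ w ∈ W, (k : ℕ∞) ≤ Order.coheight w) :
    ∀ j : ℕ, j ≤ N + 1 → ∃ A : Fin j → Fin (N + 1) → ℂ, LinearIndependent ℂ A ∧
      ∀ z ∈ W, (∀ i, linForm N (A i) ∈ (ι.left.base z).asHomogeneousIdeal) →
        Order.height z + j + k ≤ n := by
  haveI := hY.smoothOfRelativeDimension
  haveI := hY.geometricallyIrreducible
  haveI : IrreducibleSpace ↥Y.left := GeometricallyIrreducible.irreducibleSpace_of_subsingleton Y.hom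
  haveI := Motives.IsSmoothProjective.isLocallyNoetherian_holds hY
  haveI := Motives.IsSmoothProjective.compactSpace_holds hY
  haveI : IsNoetherian Y.left := {}
  have hdim : ∀ z : Y.left, Order.height z + Order.coheight z = n :=
    Motives.height_add_coheight_eq_of_smoothOfRelativeDimension Y.hom n
  have hfinh : ∀ z : Y.left, Order.height z ≠ ⊤ := fun z ↦
    (lt_of_le_of_lt (le_self_add.trans (hdim z).le) (ENat.coe_lt_top n)).ne
  intro j
  induction j with
  | zero =>
    intro _
    refine ⟨fun i ↦ Fin.elim0 i, linearIndependent_empty_type, fun z hz _ ↦ ?_⟩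
    have h1 : Order.height z + (k : ℕ∞) ≤ Order.height z + Order.coheight z :=
      add_le_add le_rfl (hWk z hz)
    calc Order.height z + ((0 : ℕ) : ℕ∞) + (k : ℕ∞) = Order.height z + (k : ℕ∞) := by simp
      _ ≤ Order.height z + Order.coheight z := h1
      _ = n := hdim z
  | succ j ih =>
    intro hj
    obtain ⟨A, hA, hAz⟩ := ih (by omega)
    -- the closed subset `S = W ∩ ι⁻¹ V₊(ℓ_{A i})ᵢ` of the Noetherian sober space `Y`
    set S : Set Y.left := {z | z ∈ W ∧ ∀ i, linForm N (A i) ∈ (ι.left.base z).asHomogeneousIdeal}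
      with hSdef
    have hSeq : S = W ∩ ι.left.base ⁻¹' linearSubspace N A :=
      Set.ext fun z ↦ and_congr_right fun _ ↦ (mem_linearSubspace_iff A (ι.left.base z)).symm
    have hS : IsClosed S := hSeq ▸ hW.inter ((isClosed_linearSubspace A).preimage ι.left.continuous)
    haveI : QuasiSober S := hS.isClosedEmbedding_subtypeVal.quasiSober
    haveI : Finite (irreducibleComponents S) :=
      (TopologicalSpace.NoetherianSpace.finite_irreducibleComponents (α := S)).to_subtype
    let G : Set Y.left :=
      Set.range fun t : irreducibleComponents S ↦ ((t.2.1.genericPoint : S) : Y.left)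
    have hGfin : G.Finite := Set.finite_range _
    have hGS : G ⊆ S := by rintro _ ⟨t, rfl⟩; exact Subtype.prop _
    have hGcover : ∀ z ∈ S, ∃ η ∈ G, η ⤳ z := by
      intro z hz
      have ht : irreducibleComponent (⟨z, hz⟩ : S) ∈ irreducibleComponents S :=
        irreducibleComponent_mem_irreducibleComponents _
      refine ⟨_, ⟨⟨_, ht⟩, rfl⟩, ?_⟩
      have hgen : IsGenericPoint ht.1.genericPoint (closure (irreducibleComponent (⟨z, hz⟩ : S))) :=
        ht.1.isGenericPoint_genericPoint_closure
      rw [isClosed_irreducibleComponent.closure_eq] at hgen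
      exact (hgen.specializes mem_irreducibleComponent).map continuous_subtype_val
    -- a linear form avoiding the generic points and the span of the previous forms
    haveI : Finite G := hGfin.to_subtype
    let P : Option G → Submodule ℂ (Fin (N + 1) → ℂ) := fun o ↦
      o.elim (Submodule.span ℂ (Set.range A)) fun η ↦ vanishingForms (ι.left.base η.1)
    have hP : ∀ o, P o ≠ ⊤ := by
      rintro (_ | η)
      · intro h
        have h1 : Module.finrank ℂ (Submodule.span ℂ (Set.range A)) = j := by
          rw [finrank_span_eq_card hA, Fintype.card_fin]
        change Submodule.span ℂ (Set.range A) = ⊤ at h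
        rw [h, finrank_top, Module.finrank_fin_fun] at h1
        omega
      · exact vanishingForms_ne_top _
    obtain ⟨a, ha⟩ := Submodule.exists_forall_notMem_of_forall_ne_top P hP
    refine ⟨Fin.snoc A a, linearIndependent_finSnoc.2 ⟨hA, ha none⟩, fun z hzW hz ↦ ?_⟩
    have hzS : z ∈ S := ⟨hzW, fun i ↦ by simpa only [Fin.snoc_castSucc] using hz (Fin.castSucc i)⟩
    have hza : linForm N a ∈ (ι.left.base z).asHomogeneousIdeal := by
      simpa only [Fin.snoc_last] using hz (Fin.last j)
    obtain ⟨η, hηG, hηz⟩ := hGcover z hzS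
    have hne : z ≠ η := by
      rintro rfl
      exact ha (some ⟨z, hηG⟩) hza
    have hlt : z < η := lt_iff_le_not_ge.2 ⟨Scheme.le_iff_specializes.2 hηz,
      fun h ↦ hne ((Scheme.le_iff_specializes.1 h).antisymm hηz).eq⟩
    have h1 : Order.height z + 1 ≤ Order.height η :=
      Order.add_one_le_of_lt (Order.height_strictMono hlt (lt_top_iff_ne_top.2 (hfinh z)))
    have hηS := hGS hηG
    calc Order.height z + ((j + 1 : ℕ) : ℕ∞) + (k : ℕ∞) = Order.height z + 1 + j + k := by
          rw [Nat.cast_succ, ← add_assoc, add_right_comm (Order.height z) (j : ℕ∞) 1]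
      _ ≤ Order.height η + j + k := by gcongr
      _ ≤ n := hAz η hηS.1 hηS.2

/-- **A linear subspace of codimension `m + 1` in general position with respect to `W`**: for `Y`
smooth projective of dimension `n`, `ι : Y → ℙᴺ_ℂ`, `W ⊆ Y` Zariski-closed with every point of
codimension `≥ k`, and `m ≤ N`, there are independent linear forms `ℓ₀, …, ℓ_m` such that every
point of `ι⁻¹V₊(ℓ₀, …, ℓ_m) ∩ W` has codimension `≥ m + 1 + k` in `Y`.
[cite: Hartshorne1977, I Thm. 7.2 and II Ex. 3.20 (d)] [cite: EisenbudHarris2016, §1.3] -/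
theorem exists_linearSubspace_le_coheight_inter (hY : Motives.IsSmoothProjective n Y)
    (ι : Y ⟶ Motives.projectiveSpace N ℂ) {W : Set Y.left} (hW : IsClosed W) {k : ℕ}
    (hWk : ∀ w ∈ W, (k : ℕ∞) ≤ Order.coheight w) {m : ℕ} (hm : m + 1 ≤ N + 1) :
    ∃ A : Fin (m + 1) → Fin (N + 1) → ℂ, LinearIndependent ℂ A ∧
      ∀ z ∈ ι.left.base ⁻¹' linearSubspace N A ∩ W, ((m + 1 + k : ℕ) : ℕ∞) ≤ Order.coheight z := by
  obtain ⟨A, hA, hAz⟩ := exists_linForms_height_add_le_of_closed hY ι hW hWk (m + 1) hm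
  refine ⟨A, hA, fun z hz ↦ ?_⟩
  haveI := hY.smoothOfRelativeDimension
  haveI := hY.geometricallyIrreducible
  haveI : IrreducibleSpace ↥Y.left := GeometricallyIrreducible.irreducibleSpace_of_subsingleton Y.hom
  have hdim : Order.height z + Order.coheight z = n :=
    Motives.height_add_coheight_eq_of_smoothOfRelativeDimension Y.hom n z
  have hfin : Order.height z ≠ ⊤ :=
    (lt_of_le_of_lt (le_self_add.trans hdim.le) (ENat.coe_lt_top n)).ne
  have h := hAz z hz.2 ((mem_linearSubspace_iff A (ι.left.base z)).1 hz.1)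
  rw [add_assoc, ← Nat.cast_add, ← hdim] at h
  exact (WithTop.add_le_add_iff_left hfin).1 h

end LinearSections

/-! ### Pulled-back ambient classes are movable -/

section Moving

open Literature.AlgebraicGeometry.Motives

variable {n N : ℕ} {Y : Motives.SchemeOver ℂ}

/-- **Classes restricted from projective space satisfy the moving hypothesis.** For `Y` smooth
projective of dimension `n` over `ℂ`, `ι : Y → ℙᴺ_ℂ`, `W ⊆ Y` Zariski-closed with every point of
codimension `≥ k`, and `a ∈ H²ˡ(ℙᴺ(ℂ); ℂ)`, the class `ι^* a` is killed off a Zariski-closed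
`T = ι⁻¹L` (a linear subspace `L` of codimension `l` in general position) meeting `W` in
codimension `≥ l + k` (Eisenbud–Harris §1.3: the easy half of the moving lemma; the class vanishes
off `ι⁻¹L` because `a` vanishes on `(ℙᴺ ∖ L)(ℂ)`, which retracts onto `ℙˡ⁻¹`).
[cite: EisenbudHarris2016, §1.3] [cite: VoisinHodgeII2003, §1.2.3 Cor. 1.24] -/
theorem map_projectiveSpace_mem_iSup_ker_restrictCompl (hY : IsSmoothProjective n Y)
    (ι : Y ⟶ projectiveSpace N ℂ) {W : Set Y.left} (hW : IsClosed W) {k l : ℕ}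
    (hWk : ∀ w ∈ W, (k : ℕ∞) ≤ Order.coheight w) (a : complexBetti (projectiveSpace N ℂ) (2 * l)) :
    complexBetti.map ι (2 * l) a ∈
      ⨆ (T : Set Y.left) (_ : IsClosed T) (_ : ∀ t ∈ T ∩ W, ((l + k : ℕ) : ℕ∞) ≤ Order.coheight t),
        LinearMap.ker (complexBetti.restrictCompl Y T (2 * l)).hom := by
  rcases Nat.eq_zero_or_pos l with rfl | hl0
  · -- `l = 0`: `T = Y`
    refine Submodule.mem_iSup_of_mem Set.univ (Submodule.mem_iSup_of_mem isClosed_univ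
      (Submodule.mem_iSup_of_mem (fun t ht ↦ by simpa using hWk t ht.2) ?_))
    have h := classesSupportedOn_univ (X := Y) (2 * 0)
    rw [classesSupportedOn] at h
    rw [h]
    exact Submodule.mem_top
  by_cases hlN : l ≤ N
  · obtain ⟨m, rfl⟩ : ∃ m, l = m + 1 := ⟨l - 1, by omega⟩
    obtain ⟨A, hA, hcodim⟩ := exists_linearSubspace_le_coheight_inter hY ι hW hWk (m := m) (by omega)
    haveI := subsingleton_singularCohomology_complexPointsCompl_linearSubspace hA
      (k := 2 * (m + 1)) (by omega)
    refine Submodule.mem_iSup_of_mem (ι.left.base ⁻¹' linearSubspace N A)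
      (Submodule.mem_iSup_of_mem ((isClosed_linearSubspace A).preimage ι.left.continuous)
        (Submodule.mem_iSup_of_mem (fun t ht ↦ ?_) ?_))
    · have h := hcodim t ht
      push_cast at h ⊢
      exact h
    · rw [LinearMap.mem_ker]
      exact restrictCompl_preimage_map_eq_zero ι (linearSubspace N A) _ a
  · -- `l > N`: `H²ˡ(ℙᴺ(ℂ); ℂ) = 0`
    haveI := ComplexPoints.subsingleton_singularCohomology_of_lt
      (isSmoothProjective_projectiveSpace_holds ℂ N) ℂ (k := 2 * l) (by omega)
    rw [Subsingleton.elim a 0, map_zero]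
    exact Submodule.zero_mem _

/-- **The moving lemma for `ℙᴺ` at the level of classes**: on `ℙᴺ_ℂ` every class of
`H²ˡ(ℙᴺ(ℂ); ℂ)` — in particular every class killed off a closed `Z` — lies in the span of the
classes killed off closed subsets `T` meeting a given Zariski-closed `W` (every point of
codimension `≥ k`) in codimension `≥ l + k` (the hypothesis `hmove` of
`cupProduct_mem_algebraicClasses_of_moving` for `X = ℙᴺ`). [cite: EisenbudHarris2016, §1.3] [cite: Fulton1998, §11.4] -/
theorem projectiveSpace_moving {l k : ℕ} ⦃Z W : Set (projectiveSpace N ℂ).left⦄ (_hZ : IsClosed Z)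
    (_hZl : ∀ z ∈ Z, (l : ℕ∞) ≤ Order.coheight z) (hW : IsClosed W)
    (hWk : ∀ w ∈ W, (k : ℕ∞) ≤ Order.coheight w) :
    LinearMap.ker (complexBetti.restrictCompl (projectiveSpace N ℂ) Z (2 * l)).hom ≤
      ⨆ (T : Set (projectiveSpace N ℂ).left) (_ : IsClosed T)
        (_ : ∀ t ∈ T ∩ W, ((l + k : ℕ) : ℕ∞) ≤ Order.coheight t),
        LinearMap.ker (complexBetti.restrictCompl (projectiveSpace N ℂ) T (2 * l)).hom := by
  intro a _
  have h := map_projectiveSpace_mem_iSup_ker_restrictCompl (isSmoothProjective_projectiveSpace_holds ℂ N)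
    (𝟙 (projectiveSpace N ℂ)) hW hWk a
  have hid : complexBetti.map (𝟙 (projectiveSpace N ℂ)) (2 * l) a = a := by
    rw [complexBetti.map_id]
    rfl
  rwa [hid] at h

/-- **`Nˡ H²ˡ ∪ Nᵏ H²ᵏ ⊆ Nˡ⁺ᵏ H²ˡ⁺²ᵏ` on `ℙᴺ_ℂ`** (Voisin II Prop. 9.20, `cl(Z · Z') = cl(Z) ∪ cl(Z')`,
for projective space, unconditionally): the tree's `cupProduct_mem_algebraicClasses_of_moving` with
the moving hypothesis supplied by `projectiveSpace_moving`.
[cite: VoisinHodgeII2003, §9.2.4 Prop. 9.20] [cite: EisenbudHarris2016, §1.3] -/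
theorem projectiveSpace_cupProduct_mem_algebraicClasses {l k : ℕ}
    {a : complexBetti (projectiveSpace N ℂ) (2 * l)} {b : complexBetti (projectiveSpace N ℂ) (2 * k)}
    (ha : a ∈ algebraicClasses (projectiveSpace N ℂ) l) (hb : b ∈ algebraicClasses (projectiveSpace N ℂ) k) :
    cupProduct (two_mul_add_two_mul l k) a b ∈ algebraicClasses (projectiveSpace N ℂ) (l + k) :=
  cupProduct_mem_algebraicClasses_of_moving (projectiveSpace_moving (N := N) (l := l) (k := k)) ha hb

end Moving

end Literature.AlgebraicGeometry.HodgeTheory
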